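import Literature.AnabelianGeometry.SemiGraphs.CompactInVerticialAtCoveringGraph
import Literature.AnabelianGeometry.SemiGraphs.CoveringGraphGaloisCountable
import Literature.AnabelianGeometry.SemiGraphs.TemperedVerticialDistinctSameVertex
import HarnessLib

/-!
# The vertices of a covering semi-graph of anabelioids over a vertex `v` are the classes of the
# verticial subgroups `π̂₁(G_v) ↪ π₁^temp(G)` modulo the open stabiliser ([SemiAnbd] §3, Ex. 3.10 / Rmk. 2.2.1)

Mochizuki, *Semi-graphs of anabelioids*, Publ. RIMS **42** (2006), §3: Proposition 3.6 (v) p. 39 (the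
covering semi-graph of anabelioids `G_S → G` of a tempered covering `S`, `B^temp(G_S) ≌ B^temp(G)_S`),
Theorem 3.7 (i)/(ii) p. 40 (verticial subgroups; "if `H₁`, `H₂` are verticial subgroups … that arise from
distinct parametrization data, then `H₁ ∩ H₂` has infinite index in `H₁`"), Remark 2.2.1 p. 24 ("the image
of each `Π_v` … is equal to the stabilizer of a compatible system of vertices"), and Example 3.10 p. 44 l. 14
("semi-graphs of anabelioids `𝒢_i`, `𝒢^c_i` on which `Δ_i` acts faithfully") [cite: MochizukiSemiAnbd2006,
Ex 3.10 p.44]; S. Mochizuki, *Inter-universal Teichmüller theory I*, proof of Prop. 2.4 (i) p. 50 (the action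
of `Π^tp_X/J` on the special fibre of `X_J`).

PROOF-ONLY file (abc-iut cell, layer L3, seat abc-iut-L3-t2 gen 5, row «Ex310-VERTEX-FIBRES», owner lineage of
the [SemiAnbd] §3 interface; no definition, no instance, no new named fact).  Setting: `G` coherent with the
hypotheses of Prop. 3.6, `S` a CONNECTED tempered covering with covering semi-graph of anabelioids `G_S`
(`CovObj.coveringGraph`: its vertices over `v` are the `Π_v`-orbits `ω` of the fibre `S_v`), charts `c` of `G`
and `c_S` of `G_S`, an orbit `ω₀` of the chart image `X_S` of `S` with base point `x₀`, open stabiliser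
`U := Stab_Π(x₀)`, and the identification `φ : U ⥲ π₁^temp(G_S)` of route-T brick T1
(`CovObj.exists_chartGroup_compatIso`, Prop. 3.6 (v)).  Results:
* `exists_trace_mem_verticialSubgroups` / `exists_conj_trace_mem_verticialSubgroups` — at EVERY vertex
  `(v, ω)` of `G_S` some trace `φ(U ∩ K)` of a verticial subgroup `K` of `G` at `v` (equivalently: of a
  conjugate `γK₀γ⁻¹` of any given one) is a verticial subgroup of `G_S` (route-T brick T3's dictionary at a
  prescribed vertex, `CovObj.exists_isVerticialHom_coveringGraph_at`, read on subgroups);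
* `exists_trace_eq_of_mem_verticialSubgroups` — conversely EVERY verticial subgroup of `G_S` at `(v, ω)` is a
  trace `φ(U ∩ K)`, `K` verticial at `v`;
* `fst_eq_of_trace_mem_verticialSubgroups` — a trace `φ(U ∩ K)`, `K` verticial at `v`, is verticial over NO
  other vertex `v′ ≠ v` (Thm. 3.7 (ii) first clause + "open ∩ compact has finite index");
* `existsUnique_orbit_trace_mem_verticialSubgroups` — every verticial `K` at `v` has its trace verticial at
  EXACTLY ONE vertex `(v, ω_K)` of `G_S` over `v` (existence: T2a; uniqueness: Thm. 3.7 (ii) for `G_S`, route-T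
  heredity `thm37Hypotheses_coveringGraph`);
* `exists_mem_stab_conj_eq_of_traces_same_vertex` / `traces_same_vertex_of_mem_stab` — two verticial `K, K′` at
  `v` have their traces verticial at the same vertex of `G_S` iff `K′ = uKu⁻¹` for some `u ∈ U` (Thm. 3.7 (ii)
  second clause).
In words: **the vertices of `G_S` over `v` are in canonical bijection with the `U`-conjugacy classes of the
verticial subgroups of `π₁^temp(G)` at `v`** — the combinatorial content, at the level of vertices, of "`Δ_i`
acts on `𝒢_i` [with quotient `𝒢`]" in Example 3.10 (there `U = N_i` is normal and `Δ = π₁^temp(𝒢)` permutes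
the classes through `Δ/N_i`; sequel file).  Nothing here is about curves; no side is taken on [IUTchIII]
Cor. 3.12.
-/

noncomputable section

open CategoryTheory CategoryTheory.Limits Topology

namespace Literature.AnabelianGeometry.SemiGraphs

open Literature.AlgebraicGeometry.Frobenioids (IsConnectedObj)
open Literature.AlgebraicGeometry.Frobenioids.QuasiTemperoid.BTempConnected (hom_ρ ρ_one_apply
  ρ_mul_apply ρ_inv_apply)
open GaloisObjects (iso_inv_hom_apply iso_hom_inv_apply)

universe u

/-! ### Two group-theoretic helpers -/

/-- An open subgroup has finite index relative to a compact subgroup. [folklore] -/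
private theorem relIndex_ne_zero_of_isOpen_of_isCompact {G : Type u} [Group G] [TopologicalSpace G]
    [IsTopologicalGroup G] {A B : Subgroup G} (hA : IsOpen (A : Set G)) (hB : IsCompact (B : Set G)) :
    A.relIndex B ≠ 0 := by
  haveI : CompactSpace B := isCompact_iff_compactSpace.mp hB
  have hopen : IsOpen ((A.subgroupOf B : Subgroup B) : Set B) := hA.preimage continuous_subtype_val
  haveI : Finite (B ⧸ A.subgroupOf B) := Subgroup.quotient_finite_of_isOpen _ hopen
  exact (Subgroup.finiteIndex_of_finite_quotient (H := A.subgroupOf B)).index_ne_zero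

/-- Conjugating a subgroup by one of its elements does not change it. [folklore] -/
private theorem map_conj_eq_self_of_mem {G : Type u} [Group G] {K : Subgroup G} {g : G} (hg : g ∈ K) :
    K.map (MulAut.conj g).toMonoidHom = K := by
  ext x
  simp only [Subgroup.mem_map, MulEquiv.coe_toMonoidHom, MulAut.conj_apply]
  constructor
  · rintro ⟨y, hy, rfl⟩
    exact K.mul_mem (K.mul_mem hg hy) (K.inv_mem hg)
  · intro hx
    exact ⟨g⁻¹ * x * g, K.mul_mem (K.mul_mem (K.inv_mem hg) hx) hg, by group⟩

/-- For `u ∈ U` and a homomorphism `φ` on `U`: conjugating the `φ`-image of the trace `U ∩ L` by `φ u` gives the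
`φ`-image of the trace of `uLu⁻¹`. [folklore] -/
private theorem map_conj_map_subgroupOf {G H : Type u} [Group G] [Group H] {U : Subgroup G} (φ : U →* H)
    (L : Subgroup G) (u : U) :
    ((L.subgroupOf U).map φ).map (MulAut.conj (φ u)).toMonoidHom =
      ((L.map (MulAut.conj (u : G)).toMonoidHom).subgroupOf U).map φ := by
  ext h
  simp only [Subgroup.mem_map, Subgroup.mem_subgroupOf, MulEquiv.coe_toMonoidHom, MulAut.conj_apply]
  constructor
  · rintro ⟨_, ⟨w, hw, rfl⟩, rfl⟩
    refine ⟨u * w * u⁻¹, ⟨(w : G), hw, by simp⟩, by simp [map_mul, map_inv]⟩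
  · rintro ⟨w, ⟨l, hl, hlw⟩, rfl⟩
    refine ⟨φ (u⁻¹ * w * u), ⟨u⁻¹ * w * u, ?_, rfl⟩, ?_⟩
    · have : ((u⁻¹ * w * u : U) : G) = l := by
        simp only [Subgroup.coe_mul, Subgroup.coe_inv, ← hlw]; group
      show ((u⁻¹ * w * u : U) : G) ∈ L
      rw [this]; exact hl
    · simp only [map_mul, map_inv]; group

namespace ProfiniteSemiGraph

namespace CovObj

variable {𝒢 : ProfiniteSemiGraph.{u}} (S : CovObj 𝒢)

/-! ### The dictionary at a prescribed vertex of `G_S`, on subgroups -/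

section Dictionary

/-! Standing data of this section (explicit in every statement): `G` coherent with the hypotheses of
Prop. 3.6, a chart `c`, a connected tempered `S` with a chart `c_S` of `G_S`, an orbit `ω₀` of the chart image
`X_S` (base point `x₀ = Quot.out ω₀`, open stabiliser `U = Stab_Π(x₀)`), and `φ : U → π₁^temp(G_S)`
compatible with the explicit equivalences (route-T brick T1). -/

/-- **Every vertex `(v, ω)` of `G_S` over `v` carries the trace `φ(U ∩ K)` of some verticial subgroup `K` of `G`
at `v` as a verticial subgroup** (`U = Stab_Π(x₀)`; brick T3's `exists_isVerticialHom_coveringGraph_at`, read on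
the images). [cite: MochizukiSemiAnbd2006, Thm 3.7(i) p.40] -/
theorem exists_trace_mem_verticialSubgroups (h36 : 𝒢.Prop36Hypotheses) (hcoh : 𝒢.IsCoherent)
    (c : TemperedPiChart 𝒢) (hS : S.IsTempered) (hSc : IsConnectedObj (⟨S, hS⟩ : BTempCat 𝒢))
    (cS : TemperedPiChart S.coveringGraph) (ω₀ : BTemp.Orbits (c.equiv.functor.obj ⟨S, hS⟩))
    (φ : BTemp.stab (c.equiv.functor.obj ⟨S, hS⟩) (Quot.out ω₀) →ₜ* cS.G)
    (hφ : Nonempty (cS.equiv.inverse ⋙ (S.etaleEquiv uniformSplitting_holds h36 hcoh hS).functor ⋙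
          (Over.postEquiv (⟨S, hS⟩ : BTempCat 𝒢) c.equiv).functor ⋙
          BTemp.fibreFamily (c.equiv.functor.obj ⟨S, hS⟩) ⋙
          Pi.eval (fun ω => BTemp (BTemp.stab (c.equiv.functor.obj ⟨S, hS⟩) (Quot.out ω))) ω₀ ≅
        BTemp.res φ))
    (v : 𝒢.graph.Vertex) (ω : BTemp.Orbits (S.SV v)) :
    ∃ K ∈ verticialSubgroups c v,
      (K.subgroupOf (BTemp.stab (c.equiv.functor.obj ⟨S, hS⟩) (Quot.out ω₀))).map φ.toMonoidHom ∈
        verticialSubgroups cS (⟨v, ω⟩ : S.coveringGraph.graph.Vertex) := by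
  obtain ⟨χ, ψ, hχv, hψ, hiff, hvert⟩ :=
    S.exists_isVerticialHom_coveringGraph_at h36 hcoh c hS hSc cS ω₀ φ hφ v ω
  refine ⟨χ.toMonoidHom.range, ⟨χ, hχv, rfl⟩, φ.comp ψ, hvert, ?_⟩
  -- the range of `φ ∘ ψ` is `φ` of the trace `U ∩ range χ`
  have hψr : ψ.toMonoidHom.range =
      χ.toMonoidHom.range.subgroupOf (BTemp.stab (c.equiv.functor.obj ⟨S, hS⟩) (Quot.out ω₀)) := by
    ext u
    simp only [MonoidHom.mem_range, Subgroup.mem_subgroupOf, ContinuousMonoidHom.coe_toMonoidHom]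
    constructor
    · rintro ⟨h, rfl⟩
      exact ⟨(h : 𝒢.Gv v), (hψ h).symm⟩
    · rintro ⟨b, hb⟩
      have hb' : χ b = (u : c.G) := hb
      have hbmem : b ∈ BTemp.stab (S.SV v) (Quot.out ω) := (hiff b).mpr (by rw [hb']; exact u.2)
      refine ⟨⟨b, hbmem⟩, Subtype.ext ?_⟩
      show ((ψ ⟨b, hbmem⟩ : BTemp.stab (c.equiv.functor.obj ⟨S, hS⟩) (Quot.out ω₀)) : c.G) = u
      rw [hψ]; exact hb'
  change _ = (φ.toMonoidHom.comp ψ.toMonoidHom).range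
  rw [MonoidHom.range_comp, hψr]

/-- The same for a conjugate of a PRESCRIBED verticial subgroup `K` of `G` at `v`: some trace `φ(U ∩ γKγ⁻¹)` is a
verticial subgroup of `G_S` at `(v, ω)` (all verticial subgroups at `v` are conjugate, Prop. 3.2).
[cite: MochizukiSemiAnbd2006, Thm 3.7(i) p.40] -/
theorem exists_conj_trace_mem_verticialSubgroups (h36 : 𝒢.Prop36Hypotheses) (hcoh : 𝒢.IsCoherent)
    (c : TemperedPiChart 𝒢) (hS : S.IsTempered) (hSc : IsConnectedObj (⟨S, hS⟩ : BTempCat 𝒢))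
    (cS : TemperedPiChart S.coveringGraph) (ω₀ : BTemp.Orbits (c.equiv.functor.obj ⟨S, hS⟩))
    (φ : BTemp.stab (c.equiv.functor.obj ⟨S, hS⟩) (Quot.out ω₀) →ₜ* cS.G)
    (hφ : Nonempty (cS.equiv.inverse ⋙ (S.etaleEquiv uniformSplitting_holds h36 hcoh hS).functor ⋙
          (Over.postEquiv (⟨S, hS⟩ : BTempCat 𝒢) c.equiv).functor ⋙
          BTemp.fibreFamily (c.equiv.functor.obj ⟨S, hS⟩) ⋙
          Pi.eval (fun ω => BTemp (BTemp.stab (c.equiv.functor.obj ⟨S, hS⟩) (Quot.out ω))) ω₀ ≅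
        BTemp.res φ))
    (v : 𝒢.graph.Vertex) (ω : BTemp.Orbits (S.SV v))
    {K : Subgroup c.G} (hK : K ∈ verticialSubgroups c v) :
    ∃ γ : c.G, ((K.map (MulAut.conj γ).toMonoidHom).subgroupOf
        (BTemp.stab (c.equiv.functor.obj ⟨S, hS⟩) (Quot.out ω₀))).map φ.toMonoidHom ∈
      verticialSubgroups cS (⟨v, ω⟩ : S.coveringGraph.graph.Vertex) := by
  obtain ⟨K', hK', hmem⟩ := S.exists_trace_mem_verticialSubgroups h36 hcoh c hS hSc cS ω₀ φ hφ v ω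
  obtain ⟨γ, rfl⟩ := exists_conj_of_mem_verticialSubgroups c hK hK'
  exact ⟨γ, hmem⟩

/-- **Conversely, EVERY verticial subgroup of `G_S` at `(v, ω)` is a trace `φ(U ∩ K)` of a verticial subgroup `K`
of `G` at `v`** (all verticial subgroups at one vertex are conjugate — Prop. 3.2 — and `φ` is an isomorphism
`U ⥲ π₁^temp(G_S)`). [cite: MochizukiSemiAnbd2006, Thm 3.7(i) p.40] -/
theorem exists_trace_eq_of_mem_verticialSubgroups (h36 : 𝒢.Prop36Hypotheses) (hcoh : 𝒢.IsCoherent)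
    (c : TemperedPiChart 𝒢) (hS : S.IsTempered) (hSc : IsConnectedObj (⟨S, hS⟩ : BTempCat 𝒢))
    (cS : TemperedPiChart S.coveringGraph) (ω₀ : BTemp.Orbits (c.equiv.functor.obj ⟨S, hS⟩))
    (φ : BTemp.stab (c.equiv.functor.obj ⟨S, hS⟩) (Quot.out ω₀) →ₜ* cS.G)
    (hφ : Nonempty (cS.equiv.inverse ⋙ (S.etaleEquiv uniformSplitting_holds h36 hcoh hS).functor ⋙
          (Over.postEquiv (⟨S, hS⟩ : BTempCat 𝒢) c.equiv).functor ⋙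
          BTemp.fibreFamily (c.equiv.functor.obj ⟨S, hS⟩) ⋙
          Pi.eval (fun ω => BTemp (BTemp.stab (c.equiv.functor.obj ⟨S, hS⟩) (Quot.out ω))) ω₀ ≅
        BTemp.res φ))
    (hφb : Function.Bijective φ) (v : 𝒢.graph.Vertex)
    (ω : BTemp.Orbits (S.SV v)) {H : Subgroup cS.G}
    (hH : H ∈ verticialSubgroups cS (⟨v, ω⟩ : S.coveringGraph.graph.Vertex)) :
    ∃ K ∈ verticialSubgroups c v,
      H = (K.subgroupOf (BTemp.stab (c.equiv.functor.obj ⟨S, hS⟩) (Quot.out ω₀))).map φ.toMonoidHom := by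
  obtain ⟨K₀, hK₀⟩ := verticialSubgroups_nonempty h36.isQuasiCoherent h36.isGaloisCountable c v
  obtain ⟨γ, hγ⟩ := S.exists_conj_trace_mem_verticialSubgroups h36 hcoh c hS hSc cS ω₀ φ hφ v ω hK₀
  obtain ⟨m, hm⟩ := exists_conj_of_mem_verticialSubgroups cS hγ hH
  obtain ⟨u, rfl⟩ := hφb.2 m
  refine ⟨(K₀.map (MulAut.conj γ).toMonoidHom).map (MulAut.conj (u : c.G)).toMonoidHom,
    conj_mem_verticialSubgroups c (conj_mem_verticialSubgroups c hK₀ γ) u, ?_⟩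
  rw [hm]
  exact map_conj_map_subgroupOf φ.toMonoidHom _ u

/-- **The base vertex is determined**: a trace `φ(U ∩ K)` of a verticial subgroup `K` of `G` at `v` is verticial
for `G_S` over no vertex `v′ ≠ v` — if it were, it would be a trace `φ(U ∩ K′)` with `K′` verticial at `v′`,
so `K ∩ K′ ⊇ K ∩ U` would have finite index in the compact `K` (`U` open), against Thm. 3.7 (ii).
[cite: MochizukiSemiAnbd2006, Thm 3.7(ii) p.40] -/
theorem fst_eq_of_trace_mem_verticialSubgroups (h36 : 𝒢.Prop36Hypotheses) (hcoh : 𝒢.IsCoherent)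
    (c : TemperedPiChart 𝒢) (hS : S.IsTempered) (hSc : IsConnectedObj (⟨S, hS⟩ : BTempCat 𝒢))
    (cS : TemperedPiChart S.coveringGraph) (ω₀ : BTemp.Orbits (c.equiv.functor.obj ⟨S, hS⟩))
    (φ : BTemp.stab (c.equiv.functor.obj ⟨S, hS⟩) (Quot.out ω₀) →ₜ* cS.G)
    (hφ : Nonempty (cS.equiv.inverse ⋙ (S.etaleEquiv uniformSplitting_holds h36 hcoh hS).functor ⋙
          (Over.postEquiv (⟨S, hS⟩ : BTempCat 𝒢) c.equiv).functor ⋙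
          BTemp.fibreFamily (c.equiv.functor.obj ⟨S, hS⟩) ⋙
          Pi.eval (fun ω => BTemp (BTemp.stab (c.equiv.functor.obj ⟨S, hS⟩) (Quot.out ω))) ω₀ ≅
        BTemp.res φ))
    (h37 : 𝒢.Thm37Hypotheses)
    (hφb : Function.Bijective φ)
    {v v' : 𝒢.graph.Vertex} {ω' : BTemp.Orbits (S.SV v')} {K : Subgroup c.G}
    (hK : K ∈ verticialSubgroups c v)
    (h : (K.subgroupOf (BTemp.stab (c.equiv.functor.obj ⟨S, hS⟩) (Quot.out ω₀))).map φ.toMonoidHom ∈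
      verticialSubgroups cS (⟨v', ω'⟩ : S.coveringGraph.graph.Vertex)) :
    v' = v := by
  haveI := c.isTopologicalGroup
  let X : BTemp c.G := c.equiv.functor.obj ⟨S, hS⟩
  let U : Subgroup c.G := BTemp.stab X (Quot.out ω₀)
  have hUo : IsOpen (U : Set c.G) := X.property.2 _
  obtain ⟨K', hK', hKK'⟩ := S.exists_trace_eq_of_mem_verticialSubgroups h36 hcoh c hS hSc cS ω₀ φ hφ hφb v' ω' h
  have hinf : K ⊓ U = K' ⊓ U := by
    have h1 : K.subgroupOf U = K'.subgroupOf U := Subgroup.map_injective hφb.1 hKK'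
    rw [← Subgroup.subgroupOf_map_subtype K U, ← Subgroup.subgroupOf_map_subtype K' U, h1]
  by_contra hne
  have h0 : K'.relIndex K = 0 := (verticialDistinct_holds 𝒢 h37 c).1 v v' K K' hK hK' (Ne.symm hne)
  have hle : U ⊓ K ≤ K' := by rw [inf_comm, hinf]; exact inf_le_left
  have h0' : (U ⊓ K).relIndex K = 0 := Subgroup.relIndex_eq_zero_of_le_left hle h0
  rw [Subgroup.inf_relIndex_right] at h0'
  exact relIndex_ne_zero_of_isOpen_of_isCompact hUo (isCompact_of_mem_verticialSubgroups c hK) h0'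

/-- **Every verticial subgroup `K` of `G` at `v` has its trace `φ(U ∩ K)` verticial at EXACTLY ONE vertex of `G_S`
over `v`** (existence: brick T2a; uniqueness: verticial subgroups at distinct vertices of `G_S` are distinct, Thm.
3.7 (ii) for `G_S`, which satisfies the hypotheses of Thm. 3.7 when `G` does and is strictly coherent — route-T
heredity). [cite: MochizukiSemiAnbd2006, Thm 3.7(ii) p.40] -/
theorem existsUnique_orbit_trace_mem_verticialSubgroups (h36 : 𝒢.Prop36Hypotheses) (hcoh : 𝒢.IsCoherent)
    (c : TemperedPiChart 𝒢) (hS : S.IsTempered) (hSc : IsConnectedObj (⟨S, hS⟩ : BTempCat 𝒢))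
    (cS : TemperedPiChart S.coveringGraph) (ω₀ : BTemp.Orbits (c.equiv.functor.obj ⟨S, hS⟩))
    (φ : BTemp.stab (c.equiv.functor.obj ⟨S, hS⟩) (Quot.out ω₀) →ₜ* cS.G)
    (hφ : Nonempty (cS.equiv.inverse ⋙ (S.etaleEquiv uniformSplitting_holds h36 hcoh hS).functor ⋙
          (Over.postEquiv (⟨S, hS⟩ : BTempCat 𝒢) c.equiv).functor ⋙
          BTemp.fibreFamily (c.equiv.functor.obj ⟨S, hS⟩) ⋙
          Pi.eval (fun ω => BTemp (BTemp.stab (c.equiv.functor.obj ⟨S, hS⟩) (Quot.out ω))) ω₀ ≅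
        BTemp.res φ))
    (h37 : 𝒢.Thm37Hypotheses)
    (hsc : 𝒢.IsStrictlyCoherent)
    (v : 𝒢.graph.Vertex) {K : Subgroup c.G} (hK : K ∈ verticialSubgroups c v) :
    ∃! ω : BTemp.Orbits (S.SV v),
      (K.subgroupOf (BTemp.stab (c.equiv.functor.obj ⟨S, hS⟩) (Quot.out ω₀))).map φ.toMonoidHom ∈
        verticialSubgroups cS (⟨v, ω⟩ : S.coveringGraph.graph.Vertex) := by
  obtain ⟨χ₀, hχ₀, rfl⟩ := hK
  -- existence (T2a at the vertex it produces)
  obtain ⟨ω, a, χ, ψ, hχ, hψ, hiff, hvert⟩ :=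
    S.exists_isVerticialHom_coveringGraph h36 hcoh c hS cS ω₀ φ hφ v χ₀ hχ₀
  have hrange : χ.toMonoidHom.range = χ₀.toMonoidHom.range := by
    have hg : ∀ b, (χ₀ a)⁻¹ * χ₀ b * (χ₀ a)⁻¹⁻¹ = χ b := fun b => by
      rw [hχ b, map_mul, map_mul, map_inv, inv_inv]
    rw [range_eq_map_conj_of_conj_eq c χ₀ χ (χ₀ a)⁻¹ hg]
    exact map_conj_eq_self_of_mem (χ₀.toMonoidHom.range.inv_mem ⟨a, rfl⟩)
  have hψr : ψ.toMonoidHom.range =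
      χ₀.toMonoidHom.range.subgroupOf (BTemp.stab (c.equiv.functor.obj ⟨S, hS⟩) (Quot.out ω₀)) := by
    rw [← hrange]
    ext u
    simp only [MonoidHom.mem_range, Subgroup.mem_subgroupOf, ContinuousMonoidHom.coe_toMonoidHom]
    constructor
    · rintro ⟨h, rfl⟩
      exact ⟨(h : 𝒢.Gv v), (hψ h).symm⟩
    · rintro ⟨b, hb⟩
      have hb' : χ b = (u : c.G) := hb
      have hbmem : b ∈ BTemp.stab (S.SV v) (Quot.out ω) := (hiff b).mpr (by rw [hb']; exact u.2)
      refine ⟨⟨b, hbmem⟩, Subtype.ext ?_⟩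
      show ((ψ ⟨b, hbmem⟩ : BTemp.stab (c.equiv.functor.obj ⟨S, hS⟩) (Quot.out ω₀)) : c.G) = u
      rw [hψ]; exact hb'
  have hmem : (χ₀.toMonoidHom.range.subgroupOf
      (BTemp.stab (c.equiv.functor.obj ⟨S, hS⟩) (Quot.out ω₀))).map φ.toMonoidHom ∈
        verticialSubgroups cS (⟨v, ω⟩ : S.coveringGraph.graph.Vertex) := by
    refine ⟨φ.comp ψ, hvert, ?_⟩
    change _ = (φ.toMonoidHom.comp ψ.toMonoidHom).range
    rw [MonoidHom.range_comp, hψr]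
  refine ⟨ω, hmem, fun ω' hω' => ?_⟩
  -- uniqueness: the same subgroup cannot be verticial at two vertices of `G_S`
  by_contra hne
  have h37S : S.coveringGraph.Thm37Hypotheses := S.thm37Hypotheses_coveringGraph h37 hsc hS hSc
  have hne' : (⟨v, ω'⟩ : S.coveringGraph.graph.Vertex) ≠ ⟨v, ω⟩ := fun h =>
    hne (eq_of_heq (Sigma.mk.inj_iff.mp h).2)
  have h0 := (verticialDistinct_holds S.coveringGraph h37S cS).1 _ _ _ _ hω' hmem hne'
  rw [Subgroup.relIndex_self] at h0
  exact one_ne_zero h0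

/-- **`U`-conjugate verticial subgroups have their traces verticial at the same vertex of `G_S`**: for
`u ∈ U`, `φ(U ∩ uKu⁻¹) = φ(u) φ(U ∩ K) φ(u)⁻¹` is a conjugate in `π₁^temp(G_S)`.
[cite: MochizukiSemiAnbd2006, Thm 3.7(i) p.40] -/
theorem traces_same_vertex_of_mem_stab (c : TemperedPiChart 𝒢) (hS : S.IsTempered)
    (cS : TemperedPiChart S.coveringGraph) (ω₀ : BTemp.Orbits (c.equiv.functor.obj ⟨S, hS⟩))
    (φ : BTemp.stab (c.equiv.functor.obj ⟨S, hS⟩) (Quot.out ω₀) →ₜ* cS.G)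
    {v : 𝒢.graph.Vertex} {ω : BTemp.Orbits (S.SV v)} {K : Subgroup c.G}
    (h : (K.subgroupOf (BTemp.stab (c.equiv.functor.obj ⟨S, hS⟩) (Quot.out ω₀))).map φ.toMonoidHom ∈
      verticialSubgroups cS (⟨v, ω⟩ : S.coveringGraph.graph.Vertex))
    (u : BTemp.stab (c.equiv.functor.obj ⟨S, hS⟩) (Quot.out ω₀)) :
    ((K.map (MulAut.conj (u : c.G)).toMonoidHom).subgroupOf
        (BTemp.stab (c.equiv.functor.obj ⟨S, hS⟩) (Quot.out ω₀))).map φ.toMonoidHom ∈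
      verticialSubgroups cS (⟨v, ω⟩ : S.coveringGraph.graph.Vertex) := by
  rw [← map_conj_map_subgroupOf φ.toMonoidHom K u]
  exact conj_mem_verticialSubgroups cS h (φ u)

/-- **Injectivity up to `U`-conjugacy**: if two verticial subgroups `K, K′` of `G` at `v` have their traces
verticial at the SAME vertex of `G_S`, then `K′ = uKu⁻¹` for some `u ∈ U` — the two traces are conjugate in
`π₁^temp(G_S) ≅ U`, so `K′` and `uKu⁻¹` are verticial subgroups at `v` sharing the finite-index subgroup
`U ∩ K′` of `K′`, which by Thm. 3.7 (ii) (second clause) forces `K′ = uKu⁻¹`.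
[cite: MochizukiSemiAnbd2006, Thm 3.7(ii) p.40] -/
theorem exists_mem_stab_conj_eq_of_traces_same_vertex (c : TemperedPiChart 𝒢) (hS : S.IsTempered)
    (cS : TemperedPiChart S.coveringGraph) (ω₀ : BTemp.Orbits (c.equiv.functor.obj ⟨S, hS⟩))
    (φ : BTemp.stab (c.equiv.functor.obj ⟨S, hS⟩) (Quot.out ω₀) →ₜ* cS.G)
    (h37 : 𝒢.Thm37Hypotheses) (hφb : Function.Bijective φ)
    {v : 𝒢.graph.Vertex} {ω : BTemp.Orbits (S.SV v)} {K K' : Subgroup c.G}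
    (hK : K ∈ verticialSubgroups c v) (hK' : K' ∈ verticialSubgroups c v)
    (h : (K.subgroupOf (BTemp.stab (c.equiv.functor.obj ⟨S, hS⟩) (Quot.out ω₀))).map φ.toMonoidHom ∈
      verticialSubgroups cS (⟨v, ω⟩ : S.coveringGraph.graph.Vertex))
    (h' : (K'.subgroupOf (BTemp.stab (c.equiv.functor.obj ⟨S, hS⟩) (Quot.out ω₀))).map φ.toMonoidHom ∈
      verticialSubgroups cS (⟨v, ω⟩ : S.coveringGraph.graph.Vertex)) :
    ∃ u : BTemp.stab (c.equiv.functor.obj ⟨S, hS⟩) (Quot.out ω₀),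
      K' = K.map (MulAut.conj (u : c.G)).toMonoidHom := by
  haveI := c.isTopologicalGroup
  let X : BTemp c.G := c.equiv.functor.obj ⟨S, hS⟩
  let U : Subgroup c.G := BTemp.stab X (Quot.out ω₀)
  have hUo : IsOpen (U : Set c.G) := X.property.2 _
  -- the two traces are conjugate in `π₁^temp(G_S)`, by `φ u` say
  obtain ⟨m, hm⟩ := exists_conj_of_mem_verticialSubgroups cS h h'
  obtain ⟨u, rfl⟩ := hφb.2 m
  refine ⟨u, ?_⟩
  rw [show φ u = φ.toMonoidHom u from rfl, map_conj_map_subgroupOf φ.toMonoidHom K u] at hm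
  -- so `K' ∩ U = uKu⁻¹ ∩ U`
  set K'' : Subgroup c.G := K.map (MulAut.conj (u : c.G)).toMonoidHom with hK''def
  have hK''v : K'' ∈ verticialSubgroups c v := conj_mem_verticialSubgroups c hK u
  have hinf : K' ⊓ U = K'' ⊓ U := by
    have h1 : K'.subgroupOf U = K''.subgroupOf U := Subgroup.map_injective hφb.1 hm
    rw [← Subgroup.subgroupOf_map_subtype K' U, ← Subgroup.subgroupOf_map_subtype K'' U, h1]
  -- `K' = g K'' g⁻¹`; if `g ∉ K''` the intersection would have infinite index in `K''` (Thm 3.7 (ii))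
  obtain ⟨g, hg⟩ := exists_conj_of_mem_verticialSubgroups c hK''v hK'
  by_cases hgK : g ∈ K''
  · rw [hg]; exact map_conj_eq_self_of_mem hgK
  · exfalso
    have h2 := (verticialDistinct_holds 𝒢 h37 c).2 v K'' hK''v 1 g (by simpa using hgK)
    have h1 : K''.map (MulAut.conj (1 : c.G)).toMonoidHom = K'' := map_conj_eq_self_of_mem K''.one_mem
    rw [h1, ← hg] at h2
    -- `h2 : K'.relIndex K'' = 0`, but `U ∩ K'' ≤ K'` has finite index in `K''`
    have hle : U ⊓ K'' ≤ K' := by rw [inf_comm, ← hinf]; exact inf_le_left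
    have h0' : (U ⊓ K'').relIndex K'' = 0 := Subgroup.relIndex_eq_zero_of_le_left hle h2
    rw [Subgroup.inf_relIndex_right] at h0'
    exact relIndex_ne_zero_of_isOpen_of_isCompact hUo (isCompact_of_mem_verticialSubgroups c hK''v) h0'

end Dictionary

end CovObj

end ProfiniteSemiGraph

end Literature.AnabelianGeometry.SemiGraphs

end
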